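/-
Copyright: width seat `ym-line-sll-p2` (prover-ym-line-sll-p2-g2-0), route `SoftLoopLongLag`, crux T′ `ColdBoxSoftLoopLagFloor`
(stmt-QuantumFields-24180), line `birth`, registered stub E1a `stub_innerFlatLagFloorG`, brick 7b (exponent bookkeeping, part 2).
-/
import Summits.QuantumFields.YangMills.Theorems.SoftLoopLongLagInnerFlatExponents

/-!
# Route `SoftLoopLongLag`, crux T′, stub E1a `stub_innerFlatLagFloorG`, brick E1a-7b «Exponents II»: the remaining four error terms of the
# inner flat lag floor are eventually `≤ β^{−a}/6`

Continuation of `Theorems/SoftLoopLongLagInnerFlatExponents.lean`: the Gaussian bad-event term `6M²p` and the Cauchy–Schwarz term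
`√p(2MK + 3K² + K²)` (exponentially small through the sibling's `badMass_le`, `sqrt_badMass_le`), the cubic remainder `2τ(M + K)`
(exponent `13ε + 25a − 1/2`), and the large-field conditioning term `6(n·2βN)²e^{−β^{3a}}`.
No sorry; no new definition; standard axioms.  HONEST LABEL: rung R2xi-G RECORD label (leaf `WeakCouplingRates.XiPow`, an UPPER bound on the
lattice mass gap); NOT the Clay mass gap; no summit statement is touched.
-/

set_option autoImplicit false

noncomputable section

open MeasureTheory ProbabilityTheory Finset Real Filter Topology Metric
open Literature.Probability.LatticeModels (Site)
open Literature.MathematicalPhysics.QuantumLattice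
open scoped Matrix.Norms.Frobenius
open Literature.MathematicalPhysics.QuantumFieldTheory (LatticeRep IsCompactSimpleLieGroup)
open Literature.MathematicalPhysics.QuantumFieldTheory.LatticeMaxwell
open Literature.MathematicalPhysics.QuantumFieldTheory.AxialGauge
open Summit.QuantumFields.YangMills.Theorems.WeakCouplingRates
open Summit.QuantumFields.YangMills.Theorems.FreeEnergyLogCoefficient
open Summit.QuantumFields.YangMills.Theorems.ColdBoxAllGroups

namespace Summit.QuantumFields.YangMills.Theorems.SoftLoopLongLag

/-- **Error 3 (Gaussian bad event)**: `6M²p ≤ β^{−a}/6` eventually. -/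
theorem eventually_err3_le (D : ℕ) {ε a : ℝ} (hε : 0 < ε) (ha : 0 < a) (hs : ε + (5 * a - 1 / 2) ≤ 0) :
    ∀ᶠ β : ℝ in atTop,
      6 * (((timeZeroCube ⌈β ^ ε⌉₊).card : ℝ) *
            (β * (4 * (⌈β ^ ε⌉₊ : ℝ) * (2 * ((12 * (⌈β ^ a⌉₊ : ℝ) ^ 2 + 2 * ⌈β ^ a⌉₊ + 1) *
              (Real.sqrt 2 * Real.sqrt (β ^ (2 * (3 * a) - 1)))))) ^ 2 / 2 +
              9 * β * (4 * (⌈β ^ ε⌉₊ : ℝ) * (2 * ((12 * (⌈β ^ a⌉₊ : ℝ) ^ 2 + 2 * ⌈β ^ a⌉₊ + 1) *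
                (Real.sqrt 2 * Real.sqrt (β ^ (2 * (3 * a) - 1)))))) ^ 3)) ^ 2 *
          (240 * (D : ℝ) * (2 * (⌈β ^ a⌉₊ : ℝ) + 1) ^ 4 * Real.exp (-(β ^ (3 * a) / (2 * (Real.sqrt D + 1))) ^ 2 / 2)) ≤
        β ^ (-a) / 6 := by
  set cM : ℝ := (1 / 2 + 9 * (8 * (106 * Real.sqrt 2))) * 216 * (8 * (106 * Real.sqrt 2)) ^ 2 with hcM
  have hb : (0 : ℝ) < 1 / (8 * (Real.sqrt D + 1) ^ 2) := by positivity
  refine eventually_le_rpow_div_six_exp (γ := a) (C := 6 * cM ^ 2 * (150000 * (D : ℝ))) (s := 10 * ε + 20 * a + 4 * a)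
    (a := 6 * a) (b := 1 / (8 * (Real.sqrt D + 1) ^ 2)) (by linarith) hb ?_
  intro β hβ
  have hβ0 : 0 < β := by linarith
  have hp := badMass_le D hβ ha.le
  rw [exp_neg_sq_div_two_eq] at *
  have hM := (loopSizes_le 0 hβ hε.le ha.le hs).1
  set M : ℝ := ((timeZeroCube ⌈β ^ ε⌉₊).card : ℝ) *
      (β * (4 * (⌈β ^ ε⌉₊ : ℝ) * (2 * ((12 * (⌈β ^ a⌉₊ : ℝ) ^ 2 + 2 * ⌈β ^ a⌉₊ + 1) *
        (Real.sqrt 2 * Real.sqrt (β ^ (2 * (3 * a) - 1)))))) ^ 2 / 2 +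
        9 * β * (4 * (⌈β ^ ε⌉₊ : ℝ) * (2 * ((12 * (⌈β ^ a⌉₊ : ℝ) ^ 2 + 2 * ⌈β ^ a⌉₊ + 1) *
          (Real.sqrt 2 * Real.sqrt (β ^ (2 * (3 * a) - 1)))))) ^ 3) with hMdef
  have hM0 : 0 ≤ M := by
    rw [hMdef]; exact mul_nonneg (Nat.cast_nonneg _) (by positivity)
  have hcM0 : 0 ≤ cM := by positivity
  have hM2 : M ^ 2 ≤ cM ^ 2 * β ^ (10 * ε + 20 * a) := by
    have e : (β ^ (5 * ε + 10 * a)) ^ 2 = β ^ (10 * ε + 20 * a) := by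
      rw [← Real.rpow_natCast, ← Real.rpow_mul hβ0.le]; congr 1; push_cast; ring
    rw [← hcM] at hM
    calc M ^ 2 ≤ (cM * β ^ (5 * ε + 10 * a)) ^ 2 := pow_le_pow_left₀ hM0 hM 2
      _ = _ := by rw [mul_pow, e]
  have h6M : 0 ≤ 6 * M ^ 2 := by positivity
  calc 6 * M ^ 2 * (240 * (D : ℝ) * (2 * (⌈β ^ a⌉₊ : ℝ) + 1) ^ 4 * Real.exp (-((β ^ (3 * a) / (2 * (Real.sqrt D + 1))) ^ 2 / 2)))
      ≤ 6 * (cM ^ 2 * β ^ (10 * ε + 20 * a)) *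
          (150000 * (D : ℝ) * β ^ (4 * a) * Real.exp (-(1 / (8 * (Real.sqrt D + 1) ^ 2) * β ^ (6 * a)))) :=
        mul_le_mul (mul_le_mul_of_nonneg_left hM2 (by norm_num)) hp (by positivity) (by positivity)
    _ = 6 * cM ^ 2 * (150000 * (D : ℝ)) * (β ^ (10 * ε + 20 * a) * β ^ (4 * a)) *
          Real.exp (-(1 / (8 * (Real.sqrt D + 1) ^ 2) * β ^ (6 * a))) := by ring
    _ = _ := by rw [← Real.rpow_add hβ0]

/-- **Error 4 (cubic remainder)**: `2τ(M + K) ≤ β^{−a}/6` eventually (`4ε ≤ a ≤ 1/100`). -/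
theorem eventually_err4_le (D : ℕ) {ε a : ℝ} (hε : 0 < ε) (h4 : 4 * ε ≤ a) (ha1 : a ≤ 1 / 100) :
    ∀ᶠ β : ℝ in atTop,
      2 * (((timeZeroCube ⌈β ^ ε⌉₊).card : ℝ) *
            (9 * β * (4 * (⌈β ^ ε⌉₊ : ℝ) * (2 * ((12 * (⌈β ^ a⌉₊ : ℝ) ^ 2 + 2 * ⌈β ^ a⌉₊ + 1) *
              (Real.sqrt 2 * Real.sqrt (β ^ (2 * (3 * a) - 1)))))) ^ 3)) *
          (((timeZeroCube ⌈β ^ ε⌉₊).card : ℝ) *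
              (β * (4 * (⌈β ^ ε⌉₊ : ℝ) * (2 * ((12 * (⌈β ^ a⌉₊ : ℝ) ^ 2 + 2 * ⌈β ^ a⌉₊ + 1) *
                (Real.sqrt 2 * Real.sqrt (β ^ (2 * (3 * a) - 1)))))) ^ 2 / 2 +
                9 * β * (4 * (⌈β ^ ε⌉₊ : ℝ) * (2 * ((12 * (⌈β ^ a⌉₊ : ℝ) ^ 2 + 2 * ⌈β ^ a⌉₊ + 1) *
                  (Real.sqrt 2 * Real.sqrt (β ^ (2 * (3 * a) - 1)))))) ^ 3) +
            (D : ℝ) * ((timeZeroCube ⌈β ^ ε⌉₊).card : ℝ) * (⌈β ^ ε⌉₊ : ℝ) ^ 4) ≤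
        β ^ (-a) / 6 := by
  have ha : 0 ≤ a := by linarith
  set cM : ℝ := (1 / 2 + 9 * (8 * (106 * Real.sqrt 2))) * 216 * (8 * (106 * Real.sqrt 2)) ^ 2 with hcM
  set cτ : ℝ := 9 * 216 * (8 * (106 * Real.sqrt 2)) ^ 3 with hcτ
  have hcM0 : 0 ≤ cM := by positivity
  have hcτ0 : 0 ≤ cτ := by positivity
  have hD : (0 : ℝ) ≤ D := Nat.cast_nonneg _
  refine eventually_le_rpow_div_six (γ := a) (C := 2 * cτ * (cM + 3456 * D)) (s := 6 * ε + 15 * a - 1 / 2 + (7 * ε + 10 * a))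
    (by linarith) ?_
  intro β hβ
  have hβ0 : 0 < β := by linarith
  have hs : ε + (5 * a - 1 / 2) ≤ 0 := by linarith
  obtain ⟨hM, hτ, hK⟩ := loopSizes_le D hβ hε.le ha hs
  rw [← hcM] at hM
  rw [← hcτ] at hτ
  have hτ0 : 0 ≤ ((timeZeroCube ⌈β ^ ε⌉₊).card : ℝ) *
      (9 * β * (4 * (⌈β ^ ε⌉₊ : ℝ) * (2 * ((12 * (⌈β ^ a⌉₊ : ℝ) ^ 2 + 2 * ⌈β ^ a⌉₊ + 1) *
        (Real.sqrt 2 * Real.sqrt (β ^ (2 * (3 * a) - 1)))))) ^ 3) :=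
    mul_nonneg (Nat.cast_nonneg _) (by have := linkRadius_nonneg β a; positivity)
  -- both summands of `M + K` are `≤ const · β^{7ε+10a}`
  have hup1 : β ^ (5 * ε + 10 * a) ≤ β ^ (7 * ε + 10 * a) := Real.rpow_le_rpow_of_exponent_le hβ (by linarith)
  have hup2 : β ^ (7 * ε) ≤ β ^ (7 * ε + 10 * a) := Real.rpow_le_rpow_of_exponent_le hβ (by linarith)
  have hMK : ((timeZeroCube ⌈β ^ ε⌉₊).card : ℝ) *
        (β * (4 * (⌈β ^ ε⌉₊ : ℝ) * (2 * ((12 * (⌈β ^ a⌉₊ : ℝ) ^ 2 + 2 * ⌈β ^ a⌉₊ + 1) *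
          (Real.sqrt 2 * Real.sqrt (β ^ (2 * (3 * a) - 1)))))) ^ 2 / 2 +
          9 * β * (4 * (⌈β ^ ε⌉₊ : ℝ) * (2 * ((12 * (⌈β ^ a⌉₊ : ℝ) ^ 2 + 2 * ⌈β ^ a⌉₊ + 1) *
            (Real.sqrt 2 * Real.sqrt (β ^ (2 * (3 * a) - 1)))))) ^ 3) +
        (D : ℝ) * ((timeZeroCube ⌈β ^ ε⌉₊).card : ℝ) * (⌈β ^ ε⌉₊ : ℝ) ^ 4 ≤ (cM + 3456 * D) * β ^ (7 * ε + 10 * a) := by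
    have h1 : cM * β ^ (5 * ε + 10 * a) ≤ cM * β ^ (7 * ε + 10 * a) := mul_le_mul_of_nonneg_left hup1 hcM0
    have h2 : 3456 * (D : ℝ) * β ^ (7 * ε) ≤ 3456 * D * β ^ (7 * ε + 10 * a) := mul_le_mul_of_nonneg_left hup2 (by positivity)
    linarith
  have e : β ^ (6 * ε + 15 * a - 1 / 2) * β ^ (7 * ε + 10 * a) = β ^ (6 * ε + 15 * a - 1 / 2 + (7 * ε + 10 * a)) := by
    rw [← Real.rpow_add hβ0]
  calc _ ≤ 2 * (cτ * β ^ (6 * ε + 15 * a - 1 / 2)) * ((cM + 3456 * D) * β ^ (7 * ε + 10 * a)) :=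
        mul_le_mul (mul_le_mul_of_nonneg_left hτ (by norm_num)) hMK (by positivity) (by positivity)
    _ = 2 * cτ * (cM + 3456 * D) * (β ^ (6 * ε + 15 * a - 1 / 2) * β ^ (7 * ε + 10 * a)) := by ring
    _ = _ := by rw [e]

/-- **Error 5 (Cauchy–Schwarz on the bad event)**: `√p·(2MK + 3K² + K²) ≤ β^{−a}/6` eventually. -/
theorem eventually_err5_le (D : ℕ) {ε a : ℝ} (hε : 0 < ε) (ha : 0 < a) (hs : ε + (5 * a - 1 / 2) ≤ 0) :
    ∀ᶠ β : ℝ in atTop,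
      Real.sqrt (240 * (D : ℝ) * (2 * (⌈β ^ a⌉₊ : ℝ) + 1) ^ 4 * Real.exp (-(β ^ (3 * a) / (2 * (Real.sqrt D + 1))) ^ 2 / 2)) *
          (2 * (((timeZeroCube ⌈β ^ ε⌉₊).card : ℝ) *
              (β * (4 * (⌈β ^ ε⌉₊ : ℝ) * (2 * ((12 * (⌈β ^ a⌉₊ : ℝ) ^ 2 + 2 * ⌈β ^ a⌉₊ + 1) *
                (Real.sqrt 2 * Real.sqrt (β ^ (2 * (3 * a) - 1)))))) ^ 2 / 2 +
                9 * β * (4 * (⌈β ^ ε⌉₊ : ℝ) * (2 * ((12 * (⌈β ^ a⌉₊ : ℝ) ^ 2 + 2 * ⌈β ^ a⌉₊ + 1) *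
                  (Real.sqrt 2 * Real.sqrt (β ^ (2 * (3 * a) - 1)))))) ^ 3)) *
              ((D : ℝ) * ((timeZeroCube ⌈β ^ ε⌉₊).card : ℝ) * (⌈β ^ ε⌉₊ : ℝ) ^ 4) +
            3 * ((D : ℝ) * ((timeZeroCube ⌈β ^ ε⌉₊).card : ℝ) * (⌈β ^ ε⌉₊ : ℝ) ^ 4) ^ 2 +
            ((D : ℝ) * ((timeZeroCube ⌈β ^ ε⌉₊).card : ℝ) * (⌈β ^ ε⌉₊ : ℝ) ^ 4) ^ 2) ≤
        β ^ (-a) / 6 := by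
  set cM : ℝ := (1 / 2 + 9 * (8 * (106 * Real.sqrt 2))) * 216 * (8 * (106 * Real.sqrt 2)) ^ 2 with hcM
  have hcM0 : 0 ≤ cM := by positivity
  have hD : (0 : ℝ) ≤ D := Nat.cast_nonneg _
  have hb : (0 : ℝ) < 1 / (16 * (Real.sqrt D + 1) ^ 2) := by positivity
  refine eventually_le_rpow_div_six_exp (γ := a) (C := Real.sqrt (150000 * (D : ℝ)) * (2 * cM * (3456 * D) + 4 * (3456 * D) ^ 2))
    (s := 2 * a + (14 * ε + 10 * a)) (a := 6 * a) (b := 1 / (16 * (Real.sqrt D + 1) ^ 2)) (by linarith) hb ?_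
  intro β hβ
  have hβ0 : 0 < β := by linarith
  have hsq := sqrt_badMass_le D hβ ha.le
  rw [exp_neg_sq_div_two_eq] at *
  obtain ⟨hM, -, hK⟩ := loopSizes_le D hβ hε.le ha.le hs
  rw [← hcM] at hM
  set M : ℝ := ((timeZeroCube ⌈β ^ ε⌉₊).card : ℝ) *
      (β * (4 * (⌈β ^ ε⌉₊ : ℝ) * (2 * ((12 * (⌈β ^ a⌉₊ : ℝ) ^ 2 + 2 * ⌈β ^ a⌉₊ + 1) *
        (Real.sqrt 2 * Real.sqrt (β ^ (2 * (3 * a) - 1)))))) ^ 2 / 2 +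
        9 * β * (4 * (⌈β ^ ε⌉₊ : ℝ) * (2 * ((12 * (⌈β ^ a⌉₊ : ℝ) ^ 2 + 2 * ⌈β ^ a⌉₊ + 1) *
          (Real.sqrt 2 * Real.sqrt (β ^ (2 * (3 * a) - 1)))))) ^ 3) with hMdef
  set K : ℝ := (D : ℝ) * ((timeZeroCube ⌈β ^ ε⌉₊).card : ℝ) * (⌈β ^ ε⌉₊ : ℝ) ^ 4 with hKdef
  have hM0 : 0 ≤ M := by
    rw [hMdef]; exact mul_nonneg (Nat.cast_nonneg _) (by positivity)
  have hK0 : 0 ≤ K := by positivity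
  have hup1 : β ^ (5 * ε + 10 * a) * β ^ (7 * ε) ≤ β ^ (14 * ε + 10 * a) := by
    rw [← Real.rpow_add hβ0]; exact Real.rpow_le_rpow_of_exponent_le hβ (by linarith)
  have hup2 : β ^ (7 * ε) * β ^ (7 * ε) ≤ β ^ (14 * ε + 10 * a) := by
    rw [← Real.rpow_add hβ0]; exact Real.rpow_le_rpow_of_exponent_le hβ (by linarith)
  have hMK : M * K ≤ cM * (3456 * D) * β ^ (14 * ε + 10 * a) := by
    calc M * K ≤ (cM * β ^ (5 * ε + 10 * a)) * (3456 * D * β ^ (7 * ε)) := mul_le_mul hM hK hK0 (by positivity)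
      _ = cM * (3456 * D) * (β ^ (5 * ε + 10 * a) * β ^ (7 * ε)) := by ring
      _ ≤ cM * (3456 * D) * β ^ (14 * ε + 10 * a) := mul_le_mul_of_nonneg_left hup1 (by positivity)
  have hKK : K ^ 2 ≤ (3456 * D) ^ 2 * β ^ (14 * ε + 10 * a) := by
    calc K ^ 2 ≤ (3456 * D * β ^ (7 * ε)) ^ 2 := pow_le_pow_left₀ hK0 hK 2
      _ = (3456 * D) ^ 2 * (β ^ (7 * ε) * β ^ (7 * ε)) := by ring
      _ ≤ (3456 * D) ^ 2 * β ^ (14 * ε + 10 * a) := mul_le_mul_of_nonneg_left hup2 (by positivity)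
  have hpoly : 2 * M * K + 3 * K ^ 2 + K ^ 2 ≤ (2 * cM * (3456 * D) + 4 * (3456 * D) ^ 2) * β ^ (14 * ε + 10 * a) := by
    nlinarith
  have hpoly0 : 0 ≤ 2 * M * K + 3 * K ^ 2 + K ^ 2 := by positivity
  have h0 : 0 ≤ Real.sqrt (150000 * (D : ℝ)) * β ^ (2 * a) * Real.exp (-(1 / (16 * (Real.sqrt D + 1) ^ 2) * β ^ (6 * a))) := by
    positivity
  calc Real.sqrt (240 * (D : ℝ) * (2 * (⌈β ^ a⌉₊ : ℝ) + 1) ^ 4 * Real.exp (-((β ^ (3 * a) / (2 * (Real.sqrt D + 1))) ^ 2 / 2))) *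
        (2 * M * K + 3 * K ^ 2 + K ^ 2)
      ≤ (Real.sqrt (150000 * (D : ℝ)) * β ^ (2 * a) * Real.exp (-(1 / (16 * (Real.sqrt D + 1) ^ 2) * β ^ (6 * a)))) *
          ((2 * cM * (3456 * D) + 4 * (3456 * D) ^ 2) * β ^ (14 * ε + 10 * a)) := mul_le_mul hsq hpoly hpoly0 h0
    _ = Real.sqrt (150000 * (D : ℝ)) * (2 * cM * (3456 * D) + 4 * (3456 * D) ^ 2) * (β ^ (2 * a) * β ^ (14 * ε + 10 * a)) *
          Real.exp (-(1 / (16 * (Real.sqrt D + 1) ^ 2) * β ^ (6 * a))) := by ring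
    _ = _ := by rw [← Real.rpow_add hβ0]

/-- **Error 6 (large-field conditioning)**: `6(n·2βN)²·e^{−β^{3a}} ≤ β^{−a}/6` eventually. -/
theorem eventually_err6_le (N : ℕ) {ε a : ℝ} (hε : 0 < ε) (ha : 0 < a) :
    ∀ᶠ β : ℝ in atTop,
      6 * (((timeZeroCube ⌈β ^ ε⌉₊).card : ℝ) * (β * (2 * N))) * (((timeZeroCube ⌈β ^ ε⌉₊).card : ℝ) * (β * (2 * N))) *
          Real.exp (-(β ^ (3 * a))) ≤ β ^ (-a) / 6 := by
  refine eventually_le_rpow_div_six_exp (γ := a) (C := 6 * (216 * (2 * N)) ^ 2) (s := 3 * ε + 1 + (3 * ε + 1)) (a := 3 * a) (b := 1)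
    (by linarith) one_pos ?_
  intro β hβ
  have hβ0 : 0 < β := by linarith
  obtain ⟨-, -, -, hn⟩ := loopSide_bounds hβ hε.le
  have hB : ((timeZeroCube ⌈β ^ ε⌉₊).card : ℝ) * (β * (2 * N)) ≤ 216 * (2 * N) * β ^ (3 * ε + 1) := by
    calc ((timeZeroCube ⌈β ^ ε⌉₊).card : ℝ) * (β * (2 * N)) ≤ (216 * β ^ (3 * ε)) * (β * (2 * N)) := by gcongr
      _ = 216 * (2 * N) * (β ^ (3 * ε) * β ^ (1 : ℝ)) := by rw [Real.rpow_one]; ring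
      _ = _ := by rw [← Real.rpow_add hβ0]
  have hB0 : 0 ≤ ((timeZeroCube ⌈β ^ ε⌉₊).card : ℝ) * (β * (2 * N)) := by positivity
  rw [one_mul]
  calc 6 * (((timeZeroCube ⌈β ^ ε⌉₊).card : ℝ) * (β * (2 * N))) * (((timeZeroCube ⌈β ^ ε⌉₊).card : ℝ) * (β * (2 * N))) *
        Real.exp (-(β ^ (3 * a)))
      ≤ 6 * (216 * (2 * N) * β ^ (3 * ε + 1)) * (216 * (2 * N) * β ^ (3 * ε + 1)) * Real.exp (-(β ^ (3 * a))) := by gcongr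
    _ = 6 * (216 * (2 * N)) ^ 2 * (β ^ (3 * ε + 1) * β ^ (3 * ε + 1)) * Real.exp (-(β ^ (3 * a))) := by ring
    _ = _ := by rw [← Real.rpow_add hβ0]

end Summit.QuantumFields.YangMills.Theorems.SoftLoopLongLag

end
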